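import Literature.Barriers.HodgeConjecture.ExceptionalHodgeClasses
import HarnessLib

/-!
# Exceptional Hodge classes (Weil 1977; Mumford 1968): what the barrier facts presuppose

Companion to `Literature/Barriers/HodgeConjecture/ExceptionalHodgeClasses.lean` (barrier catalogue,
D-0021). The two barrier facts vendored there,
`Literature.Barriers.HodgeConjecture.Weil1977_exceptionalHodgeClasses` (van Geemen, LNM 1594, Thm. 4.11)
and `Literature.Barriers.HodgeConjecture.Mumford1968_simpleFourfold_exceptionalHodgeClasses`
(loc. cit., Thm. 4.5), assert the EXISTENCE of complex abelian varieties carrying a rational class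
of Hodge type `(n, n)`. In the tree a class is of Hodge type `(p, q)` (`HodgeTheory.IsOfHodgeType`)
only through a Hodge model (`HodgeTheory.HodgeModel`: analytification + a NATURAL complex de Rham
comparison family on the model space + the Hodge decomposition of the carrier). This file records,
as proved consequences of the facts, the two inputs of the printed proof that are themselves named
facts of the tree and that every witness must therefore supply:

* `Weil1977_exceptionalHodgeClasses.exists_nonempty_hodgeModel`: an abelian variety of each even
  dimension `2n ≥ 4` WITH a Hodge model (cf. the named fact `HodgeTheory.nonempty_hodgeModel`,
  Serre GAGA §2 + de Rham + Hodge, for smooth projective varieties);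
* `Weil1977_exceptionalHodgeClasses.exists_complexDeRhamIsoFamily`: for each `n ≥ 2` a complex
  model space `E` of dimension `2n` carrying a natural complex de Rham isomorphism family, i.e. the
  named fact `Literature.NumberTheory.Transcendental.exists_complexDeRhamIsoFamily E` — de Rham's
  theorem [de Rham 1931; Wells 1980, Thm. III.4.13] in complex dimension `2n`;
* the same for Mumford's fourfolds (`E` of dimension `4`).

So neither barrier fact can be discharged (`…_holds`) before de Rham's theorem
`exists_complexDeRhamIsoFamily` is, whatever construction of the abelian varieties is used (the
printed one, van Geemen §5 and Thms. 6.11–6.12, or Mumford's CM fourfolds, 4.7): the dependency is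
kernel-checked here rather than asserted in prose. Everything in this file is proved; no definition,
no new named fact.

## References

* [vanGeemen1994HodgeAV] B. van Geemen, An introduction to the Hodge conjecture for abelian
  varieties, LNM 1594 (1994), Thm. 4.5, Thm. 4.11, §5, Thms. 6.11–6.12.
* [Weil1977HodgeRing] A. Weil, Abelian varieties and the Hodge ring, Œuvres III, 421–429.
* [deRham1931] G. de Rham, Sur l'analysis situs des variétés à n dimensions (1931).
* [WellsDACM1980] R. O. Wells, Differential Analysis on Complex Manifolds (1980), Thm. III.4.13.
* [SerreGAGA1956] J.-P. Serre, GAGA, Ann. Inst. Fourier 6 (1956), §2.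
-/

noncomputable section

namespace Literature.Barriers.HodgeConjecture

section Barriers
section HodgeConjecture

open Literature.AlgebraicGeometry.HodgeTheory

/-- A class of some Hodge type on `X` exhibits a Hodge model of `X` (the tree's `IsOfHodgeType` is
membership in `H^{p,q}` of SOME Hodge model), hence a natural complex de Rham isomorphism family on a
complex model space of dimension `N` (the `deRham` datum of the model; `dim = N` by
`IsAnalytification.finrank_eq`). [cite: WellsDACM1980, Thm. III.4.13] [cite: SerreGAGA1956, §2] -/
theorem exists_complexDeRhamIsoFamily_of_isOfHodgeType
    {N : ℕ} {X : Literature.AlgebraicGeometry.Motives.SchemeOver ℂ} {k p q : ℕ}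
    {c : Literature.AlgebraicTopology.SingularHomology.singularCohomology ℂ ℂ
      (Literature.AlgebraicGeometry.Motives.ComplexPoints X) k}
    (hc : IsOfHodgeType N X k p q c) :
    Nonempty (HodgeModel N X) ∧
      ∃ (E : Type) (_ : NormedAddCommGroup E) (_ : NormedSpace ℂ E) (_ : FiniteDimensional ℂ E),
        Module.finrank ℂ E = N ∧ Literature.NumberTheory.Transcendental.exists_complexDeRhamIsoFamily E := by
  obtain ⟨A, -⟩ := hc
  exact ⟨⟨A⟩, A.model, inferInstance, inferInstance, inferInstance, A.isAnalytification.finrank_eq,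
    A.deRham, A.deRham_isNatural⟩

/-- **Weil's abelian varieties come with Hodge models.** The barrier fact
`Weil1977_exceptionalHodgeClasses` (van Geemen 1994, Thm. 4.11) yields, for every `n ≥ 2`, a
complex abelian variety of dimension `2n`, smooth projective, together with a Hodge model of it —
the content of the named fact `HodgeTheory.nonempty_hodgeModel (2 * n) A.X` for that `A`
(analytification, Serre GAGA §2; de Rham comparison; Hodge decomposition).
[cite: vanGeemen1994HodgeAV, Thm. 4.11] [cite: SerreGAGA1956, §2] -/
theorem Weil1977_exceptionalHodgeClasses.exists_nonempty_hodgeModel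
    (h : Weil1977_exceptionalHodgeClasses) {n : ℕ} (hn : 2 ≤ n) :
    ∃ A : Literature.AlgebraicGeometry.Motives.AbelianVariety ℂ, A.dim = 2 * n ∧
      Literature.AlgebraicGeometry.Motives.IsSmoothProjective (2 * n) A.X ∧
      Nonempty (HodgeModel (2 * n) A.X) := by
  obtain ⟨A, hdim, hsp, c, -, hc, -⟩ := h n hn
  exact ⟨A, hdim, hsp, (exists_complexDeRhamIsoFamily_of_isOfHodgeType hc).1⟩

/-- **Weil's theorem presupposes de Rham's theorem in complex dimension `2n`.** The barrier fact
`Weil1977_exceptionalHodgeClasses` (van Geemen 1994, Thm. 4.11; Weil 1977) implies, for every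
`n ≥ 2`, the existence of a finite-dimensional complex model space `E` with `dim_ℂ E = 2n` carrying
a NATURAL family of isomorphisms `H^k_dR(M; ℂ) ≃ H^k(M; ℂ)` over all manifolds charted on `E`, i.e.
the tree's named fact `Literature.NumberTheory.Transcendental.exists_complexDeRhamIsoFamily E`
(de Rham 1931; Wells 1980, Thm. III.4.13): the exceptional class is of Hodge type `(n, n)`, which in
the tree is witnessed through a Hodge model of the `2n`-dimensional abelian variety, whose de Rham
datum is such a family. Consequently the fact cannot be discharged before de Rham's theorem is.
[cite: vanGeemen1994HodgeAV, Thm. 4.11] [cite: WellsDACM1980, Thm. III.4.13] -/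
theorem Weil1977_exceptionalHodgeClasses.exists_complexDeRhamIsoFamily
    (h : Weil1977_exceptionalHodgeClasses) {n : ℕ} (hn : 2 ≤ n) :
    ∃ (E : Type) (_ : NormedAddCommGroup E) (_ : NormedSpace ℂ E) (_ : FiniteDimensional ℂ E),
      Module.finrank ℂ E = 2 * n ∧ Literature.NumberTheory.Transcendental.exists_complexDeRhamIsoFamily E := by
  obtain ⟨A, -, -, c, -, hc, -⟩ := h n hn
  exact (exists_complexDeRhamIsoFamily_of_isOfHodgeType hc).2

/-- **Mumford's fourfolds presuppose de Rham's theorem in complex dimension `4`.** The barrier fact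
`Mumford1968_simpleFourfold_exceptionalHodgeClasses` (van Geemen 1994, Thm. 4.5) implies the
existence of a complex model space of dimension `4` carrying a natural complex de Rham isomorphism
family (`Literature.NumberTheory.Transcendental.exists_complexDeRhamIsoFamily`, de Rham 1931; Wells
1980, Thm. III.4.13), through the Hodge model witnessing the type `(2, 2)` of the exceptional class.
[cite: vanGeemen1994HodgeAV, Thm. 4.5] [cite: WellsDACM1980, Thm. III.4.13] -/
theorem Mumford1968_simpleFourfold_exceptionalHodgeClasses.exists_complexDeRhamIsoFamily
    (h : Mumford1968_simpleFourfold_exceptionalHodgeClasses) :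
    ∃ (E : Type) (_ : NormedAddCommGroup E) (_ : NormedSpace ℂ E) (_ : FiniteDimensional ℂ E),
      Module.finrank ℂ E = 4 ∧ Literature.NumberTheory.Transcendental.exists_complexDeRhamIsoFamily E := by
  obtain ⟨A, -, -, -, c, -, hc, -⟩ := h
  exact (exists_complexDeRhamIsoFamily_of_isOfHodgeType hc).2

end HodgeConjecture
end Barriers

end Literature.Barriers.HodgeConjecture

end
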